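import Summits.CriticalPhenomena.PercolationContinuityZ3.Theorems.PercNearOneGluingAdditiveGluingFullTieReduction
import Summits.CriticalPhenomena.PercolationContinuityZ3.Theorems.PercNearOneGluingAdditiveGluingGluePushforward
import Summits.CriticalPhenomena.PercolationContinuityZ3.Theorems.PercNearOneGluingAdditiveGluingGlueReach
import HarnessLib

/-!
# Crux `PercNearOneGluing.AdditiveGluing` (stmt-CriticalPhenomena-4576): pull-backs along the gluing of a SET of relays

Support file (`--supports stmt-CriticalPhenomena-4576`; lead-of-record prim-png-lead-4576, gen 2).  No definitions, no named
facts, no sorries.  Tools for `…AdditiveGluingSetGlueK0.lean` (the crux for every number of relays from the set-gluing kernel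
(K₀-set)).

Gluing a finite vertex set `S` = giving weight `1` to every non-loop pair inside `S`; the glued law is the image of `μ = prodBernoulli w`
under `ω ↦ ω ∪ D_S` (landed `stub_gluePushforward`) and reachability in `ω ∪ D_S` is "reachability in `ω`, possibly through `S`"
(landed `stub_glueReach`).  With two marked relays `c` (any vertex) and `s₀ ∈ S` of the glued weighting, observer `o`, target `b`,
and `CS = ⋃_{s∈S} {c ↔ s}`, `OS = ⋃_{s∈S} {o ↔ s}`, `BS = ⋃_{s∈S} {s ↔ b}` (events of the ORIGINAL weighting), this file pulls back
the six events of the one-sided weighted Kozma–Nitzan Theorem 1 (`twoStep_thm1_half`):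
`{c ↮ s₀}* ∩ {o↔c}* = CSᶜ ∩ o↔c`, `{c ↮ s₀}* ∩ {c↔b}* = CSᶜ ∩ c↔b`, `{c ↮ s₀}* ∩ {s₀↔b}* = CSᶜ ∩ BS`, `{c ↮ s₀}* = CSᶜ`,
`{o↔b}* ∩ ({o↔c} ∪ {o↔s₀})* = (o↔b ∪ (OS ∩ BS)) ∩ (o↔c ∪ OS)`, `({o↔c} ∪ {o↔s₀})* ∩ {s₀↔b}* = (o↔c ∪ OS) ∩ BS`
(`setGlue_pull_*`), after the two reachability facts `x ↔* s₀ ⟺ x ↔ S`, `s₀ ↔* y ⟺ S ↔ y` (`setGlue_reach_right/left`).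
These are the set analogues of the pair pull-backs `twoStep_glue_*` of `…TwoStepGlueTools.lean`.
[cite: KozmaNitzan2024, §3.1 Remark after Lemma 4 (pp. 9–10: gluing = probability 1), §5.3 (p. 34)] [folklore; Grimmett 1999 §1.3]
-/

namespace Summit.CriticalPhenomena.PercolationContinuityZ3.Theorems

open MeasureTheory Set Literature.Probability.LatticeModels Literature.Probability.Percolation

noncomputable section
open Classical

variable {n : ℕ}

/-! ### Reachability after gluing a set `S` (consequences of `stub_glueReach`) -/

/-- After gluing `S` (`s₀ ∈ S`): `x ↔ s₀` iff `x ↔ S` before. [folklore] -/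
theorem setGlue_reach_right (S : Finset (Fin n)) {s₀ : Fin n} (hs₀ : s₀ ∈ S) (ω : BondConfig (Fin n)) (x : Fin n) :
    (ω ∪ {e | (∀ z ∈ e, z ∈ S) ∧ ¬ e.IsDiag}) ∈ (openConn x s₀ : Set (BondConfig (Fin n))) ↔
      ∃ s ∈ S, ω ∈ (openConn x s : Set (BondConfig (Fin n))) := by
  rw [stub_glueReach]
  have hr : ω ∈ (openConn s₀ s₀ : Set (BondConfig (Fin n))) := fullTie_mem_openConn_self s₀ ω
  constructor
  · rintro (h | ⟨h, _⟩)
    · exact ⟨s₀, hs₀, h⟩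
    · exact h
  · intro h
    exact Or.inr ⟨h, ⟨s₀, hs₀, hr⟩⟩

/-- After gluing `S` (`s₀ ∈ S`): `s₀ ↔ y` iff `S ↔ y` before. [folklore] -/
theorem setGlue_reach_left (S : Finset (Fin n)) {s₀ : Fin n} (hs₀ : s₀ ∈ S) (ω : BondConfig (Fin n)) (y : Fin n) :
    (ω ∪ {e | (∀ z ∈ e, z ∈ S) ∧ ¬ e.IsDiag}) ∈ (openConn s₀ y : Set (BondConfig (Fin n))) ↔
      ∃ s ∈ S, ω ∈ (openConn s y : Set (BondConfig (Fin n))) := by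
  rw [stub_glueReach]
  have hr : ω ∈ (openConn s₀ s₀ : Set (BondConfig (Fin n))) := fullTie_mem_openConn_self s₀ ω
  constructor
  · rintro (h | ⟨_, h⟩)
    · exact ⟨s₀, hs₀, h⟩
    · exact h
  · intro h
    exact Or.inr ⟨⟨s₀, hs₀, hr⟩, h⟩

/-! ### Pull-backs of the six events of `twoStep_thm1_half` along the gluing of `S` (relays `c ∉ S` and `s₀ ∈ S`) -/

/-- `μ_{G/S}({c ↮ s₀} ∩ {o ↔ c}) = μ(CSᶜ ∩ o↔c)`. [folklore] -/
theorem setGlue_pull_Doc (w : Sym2 (Fin n) → unitInterval) (S : Finset (Fin n)) {s₀ : Fin n} (hs₀ : s₀ ∈ S) (o c : Fin n) :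
    (prodBernoulli (fun e : Sym2 (Fin n) => if (∀ x ∈ e, x ∈ S) ∧ ¬ e.IsDiag then 1 else w e)).real
        ((openConn c s₀)ᶜ ∩ openConn o c : Set (BondConfig (Fin n))) =
      (prodBernoulli w).real ((⋃ s ∈ S, (openConn c s : Set (BondConfig (Fin n))))ᶜ ∩ openConn o c) := by
  rw [stub_gluePushforward]
  congr 1
  ext ω
  simp only [Set.mem_setOf_eq, Set.mem_inter_iff, Set.mem_compl_iff, Set.mem_iUnion, exists_prop,
    setGlue_reach_right S hs₀, stub_glueReach]
  constructor
  · rintro ⟨hD, hO⟩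
    refine ⟨fun ⟨s, hs, h⟩ => hD ⟨s, hs, h⟩, ?_⟩
    rcases hO with h | ⟨_, ⟨s, hs, h⟩⟩
    · exact h
    · exact absurd ⟨s, hs, SimpleGraph.Reachable.symm h⟩ hD
  · rintro ⟨hD, hO⟩
    exact ⟨fun ⟨s, hs, h⟩ => hD ⟨s, hs, h⟩, Or.inl hO⟩

/-- `μ_{G/S}({c ↮ s₀} ∩ {c ↔ b}) = μ(CSᶜ ∩ c↔b)`. [folklore] -/
theorem setGlue_pull_Dcb (w : Sym2 (Fin n) → unitInterval) (S : Finset (Fin n)) {s₀ : Fin n} (hs₀ : s₀ ∈ S) (b c : Fin n) :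
    (prodBernoulli (fun e : Sym2 (Fin n) => if (∀ x ∈ e, x ∈ S) ∧ ¬ e.IsDiag then 1 else w e)).real
        ((openConn c s₀)ᶜ ∩ openConn c b : Set (BondConfig (Fin n))) =
      (prodBernoulli w).real ((⋃ s ∈ S, (openConn c s : Set (BondConfig (Fin n))))ᶜ ∩ openConn c b) := by
  rw [stub_gluePushforward]
  congr 1
  ext ω
  simp only [Set.mem_setOf_eq, Set.mem_inter_iff, Set.mem_compl_iff, Set.mem_iUnion, exists_prop,
    setGlue_reach_right S hs₀, stub_glueReach]
  constructor
  · rintro ⟨hD, hB⟩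
    refine ⟨fun ⟨s, hs, h⟩ => hD ⟨s, hs, h⟩, ?_⟩
    rcases hB with h | ⟨⟨s, hs, h⟩, _⟩
    · exact h
    · exact absurd ⟨s, hs, h⟩ hD
  · rintro ⟨hD, hB⟩
    exact ⟨fun ⟨s, hs, h⟩ => hD ⟨s, hs, h⟩, Or.inl hB⟩

/-- `μ_{G/S}({c ↮ s₀} ∩ {s₀ ↔ b}) = μ(CSᶜ ∩ BS)`. [folklore] -/
theorem setGlue_pull_DBS (w : Sym2 (Fin n) → unitInterval) (S : Finset (Fin n)) {s₀ : Fin n} (hs₀ : s₀ ∈ S) (b c : Fin n) :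
    (prodBernoulli (fun e : Sym2 (Fin n) => if (∀ x ∈ e, x ∈ S) ∧ ¬ e.IsDiag then 1 else w e)).real
        ((openConn c s₀)ᶜ ∩ openConn s₀ b : Set (BondConfig (Fin n))) =
      (prodBernoulli w).real ((⋃ s ∈ S, (openConn c s : Set (BondConfig (Fin n))))ᶜ ∩
        (⋃ s ∈ S, (openConn s b : Set (BondConfig (Fin n))))) := by
  rw [stub_gluePushforward]
  congr 1
  ext ω
  simp only [Set.mem_setOf_eq, Set.mem_inter_iff, Set.mem_compl_iff, Set.mem_iUnion, exists_prop,
    setGlue_reach_right S hs₀, setGlue_reach_left S hs₀]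

/-- `μ_{G/S}({c ↮ s₀}) = μ(CSᶜ)`. [folklore] -/
theorem setGlue_pull_D (w : Sym2 (Fin n) → unitInterval) (S : Finset (Fin n)) {s₀ : Fin n} (hs₀ : s₀ ∈ S) (c : Fin n) :
    (prodBernoulli (fun e : Sym2 (Fin n) => if (∀ x ∈ e, x ∈ S) ∧ ¬ e.IsDiag then 1 else w e)).real
        ((openConn c s₀)ᶜ : Set (BondConfig (Fin n))) =
      (prodBernoulli w).real ((⋃ s ∈ S, (openConn c s : Set (BondConfig (Fin n))))ᶜ) := by
  rw [stub_gluePushforward]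
  congr 1
  ext ω
  simp only [Set.mem_setOf_eq, Set.mem_compl_iff, Set.mem_iUnion, exists_prop, setGlue_reach_right S hs₀]

/-- `μ_{G/S}({o ↔ b} ∩ ({o ↔ c} ∪ {o ↔ s₀})) = μ((o↔b ∪ (OS ∩ BS)) ∩ (o↔c ∪ OS))`. [folklore] -/
theorem setGlue_pull_E (w : Sym2 (Fin n) → unitInterval) (S : Finset (Fin n)) {s₀ : Fin n} (hs₀ : s₀ ∈ S) (o b c : Fin n) :
    (prodBernoulli (fun e : Sym2 (Fin n) => if (∀ x ∈ e, x ∈ S) ∧ ¬ e.IsDiag then 1 else w e)).real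
        (openConn o b ∩ (openConn o c ∪ openConn o s₀) : Set (BondConfig (Fin n))) =
      (prodBernoulli w).real
        ((openConn o b ∪ ((⋃ s ∈ S, (openConn o s : Set (BondConfig (Fin n)))) ∩
            (⋃ s ∈ S, (openConn s b : Set (BondConfig (Fin n)))))) ∩
          (openConn o c ∪ ⋃ s ∈ S, (openConn o s : Set (BondConfig (Fin n))))) := by
  rw [stub_gluePushforward]
  congr 1
  ext ω
  simp only [Set.mem_setOf_eq, Set.mem_inter_iff, Set.mem_union, Set.mem_iUnion, exists_prop,
    setGlue_reach_right S hs₀, stub_glueReach]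
  constructor
  · rintro ⟨hB, hO⟩
    refine ⟨hB, ?_⟩
    rcases hO with (h | ⟨h, _⟩) | h
    · exact Or.inl h
    · exact Or.inr h
    · exact Or.inr h
  · rintro ⟨hB, hO⟩
    refine ⟨hB, ?_⟩
    rcases hO with h | h
    · exact Or.inl (Or.inl h)
    · exact Or.inr h

/-- `μ_{G/S}(({o ↔ c} ∪ {o ↔ s₀}) ∩ {s₀ ↔ b}) = μ((o↔c ∪ OS) ∩ BS)`. [folklore] -/
theorem setGlue_pull_F (w : Sym2 (Fin n) → unitInterval) (S : Finset (Fin n)) {s₀ : Fin n} (hs₀ : s₀ ∈ S) (o b c : Fin n) :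
    (prodBernoulli (fun e : Sym2 (Fin n) => if (∀ x ∈ e, x ∈ S) ∧ ¬ e.IsDiag then 1 else w e)).real
        ((openConn o c ∪ openConn o s₀) ∩ openConn s₀ b : Set (BondConfig (Fin n))) =
      (prodBernoulli w).real
        ((openConn o c ∪ ⋃ s ∈ S, (openConn o s : Set (BondConfig (Fin n)))) ∩
          (⋃ s ∈ S, (openConn s b : Set (BondConfig (Fin n))))) := by
  rw [stub_gluePushforward]
  congr 1
  ext ω
  simp only [Set.mem_setOf_eq, Set.mem_inter_iff, Set.mem_union, Set.mem_iUnion, exists_prop,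
    setGlue_reach_right S hs₀, setGlue_reach_left S hs₀, stub_glueReach]
  constructor
  · rintro ⟨hO, hB⟩
    refine ⟨?_, hB⟩
    rcases hO with (h | ⟨h, _⟩) | h
    · exact Or.inl h
    · exact Or.inr h
    · exact Or.inr h
  · rintro ⟨hO, hB⟩
    refine ⟨?_, hB⟩
    rcases hO with h | h
    · exact Or.inl (Or.inl h)
    · exact Or.inr h

end

end Summit.CriticalPhenomena.PercolationContinuityZ3.Theorems
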